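import Summits.KontsevichZagierPeriods.Zeta5Search.DualSeriesDenominators
import Literature.NumberTheory.Transcendental.ReciprocalBricks
import HarnessLib

/-!
# ζ(5) search — Brown–Zudilin's normalisation (35) of `F̃₇(b)`: the SHARP denominators (cell `pub-zeta5`, TYPER)

HONEST FRAMING: systematic search; no irrationality claim unless certified.

`DualSeriesDenominators.lean` proved `d^{5−o}·N(b)·c_{o,p} ∈ ℤ` with `N(b) = ∏_{pairs}(b₀−b_j−b_k)!`. Brown–Zudilin's
(35) divides moreover by `b₂! b₃!`. This file recovers that division with the tree's Taylor-coefficient arithmetic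
of Nesterenko's bricks (`Literature.NumberTheory.Transcendental.{IsDInt, polyBrick_isDInt (Zudilin 2004, Lemma 15),
recipBrickReg_isDInt (Lemma 16)}`, `Literature.Analysis.Calculus.divDeriv`):

* `divDeriv_eq_coeff` — generic bridge (Ball–Rivoal convention): if `G(t) = pfEval n K c t · (t+p+1)^K` on a
  punctured neighbourhood of `−p−1` and `G` is continuous there, then `c_{K−1−a,p} = (1/a!) G^{(a)}(−p−1)`;
* `Gfun b p` — the regularised product `(2t+b₀+2) · C(t+b₃, b₃) · C(t+b₀+1, b₂) · ∏_{pairs} [(L−1)!(t+p+1)/(block)]`,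
  `IsDInt (lcm(1..b₀)) 5 (Gfun b p) (−p−1)` (`Gfun_isDInt`), and `Gfun b p = (t+p+1)⁶ · (N(b)/(b₂!b₃!)) · R_b`
  near `−p−1` (`Gfun_eq`);
* `exists_int_data_sharp` — **`d^{5−o} · N(b)/(b₂! b₃!) · c_{o,p} ∈ ℤ`** for THE data of `R_b` (`d = lcm(1..b₀)`), hence
  `coeffU_den_sharp`, `coeffW_den_sharp`: `d·N/(b₂!b₃!)·U ∈ ℤ`, `d³·N/(b₂!b₃!)·W ∈ ℤ` — Brown–Zudilin's (35)
  normaliser exactly, up to the single `d` on `U` (the printed `F₇(b) ∈ ℚ + ℚζ(3) + ℤζ(5)` has none).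

0 sorry.
-/

noncomputable section

open Finset Filter Topology Polynomial
open Literature.NumberTheory.Transcendental
open Literature.NumberTheory.Transcendental.BallRivoal
open Literature.Analysis.Calculus

namespace Summit.KontsevichZagierPeriods.Zeta5Search

namespace DualSeriesDenominators

open DualSeries WedgeDictionary PFSteps

/-! ### The bridge: coefficients as divided derivatives -/

/-- Smoothness of `((t+p'+1)^{o+1})⁻¹` at `−p−1`, `p' ≠ p`. -/
theorem contDiffAt_inv_pow' {p p' : ℕ} (h : p' ≠ p) (o : ℕ) {N : WithTop ℕ∞} :
    ContDiffAt ℚ N (fun t : ℚ => ((t + p' + 1) ^ (o + 1))⁻¹) (-(p : ℚ) - 1) := by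
  refine (((contDiffAt_id.add contDiffAt_const).add contDiffAt_const).pow _).inv ?_
  simp only [id]
  refine pow_ne_zero _ ?_
  rw [show (-(p : ℚ) - 1 + p' + 1) = ((p' - p : ℤ) : ℚ) by push_cast; ring]
  exact_mod_cast sub_ne_zero.2 (by exact_mod_cast h : (p' : ℤ) ≠ p)

/-- **Coefficients are divided derivatives** (Ball–Rivoal convention): if `G` is continuous at `−p−1` and
`G(t) = pfEval n K c t · (t+p+1)^K` on a punctured neighbourhood, then `(1/a!) G^{(a)}(−p−1) = c_{K−1−a,p}` (`a < K`). -/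
theorem divDeriv_eq_coeff (n K : ℕ) (c : ℕ → ℕ → ℚ) (G : ℚ → ℚ) {p : ℕ} (hp : p ≤ n)
    (hG : ContinuousAt G (-(p : ℚ) - 1))
    (hGF : ∀ᶠ t : ℚ in 𝓝[≠] (-(p : ℚ) - 1), G t = pfEval n K c t * (t + p + 1) ^ K)
    {a : ℕ} (ha : a < K) :
    divDeriv a G (-(p : ℚ) - 1) = c (K - 1 - a) p := by
  set x : ℚ := -(p : ℚ) - 1 with hx
  set H : ℚ → ℚ := fun t => ∑ p' ∈ (range (n + 1)).erase p, ∑ o ∈ range K, c o p' * ((t + p' + 1) ^ (o + 1))⁻¹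
    with hH
  set F : ℚ → ℚ := fun t => ∑ o ∈ range K, c o p * (t - x) ^ (K - 1 - o) + (t - x) ^ K * H t with hF
  have hHs : ContDiffAt ℚ (⊤ : ℕ∞) H x := by
    refine ContDiffAt.sum fun p' hp' => ContDiffAt.sum fun o _ => ?_
    exact contDiffAt_const.mul (contDiffAt_inv_pow' (ne_of_mem_erase hp') o)
  have hterm : ∀ o ∈ range K, ContDiffAt ℚ (⊤ : ℕ∞) (fun t : ℚ => c o p * (t - x) ^ (K - 1 - o)) x :=
    fun o _ => contDiffAt_const.mul (contDiffAt_sub_pow _ _ _)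
  have hFs : ContDiffAt ℚ (⊤ : ℕ∞) F x :=
    (ContDiffAt.sum fun o ho => hterm o ho).add ((contDiffAt_sub_pow _ _ _).mul hHs)
  -- no poles on a punctured neighbourhood
  have hgood : ∀ᶠ t : ℚ in 𝓝[≠] x, t + p + 1 ≠ 0 ∧ ∀ p', p' ≤ n → t + p' + 1 ≠ 0 := by
    have h := eventually_ne_poles (1 : ℤ) (n + 1) ((p : ℤ) + 1)
    rw [show (-(((p : ℤ) + 1 : ℤ) : ℚ)) = x by rw [hx]; push_cast; ring] at h
    filter_upwards [h] with t ht
    refine ⟨fun h0 => ?_, fun p' hp' h0 => ?_⟩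
    · have := ht.1
      push_cast at this
      exact this (by linarith)
    · have := ht.2 p' (mem_range.2 (by omega))
      push_cast at this
      exact this (by linarith)
  -- `G = F` near `x`
  have hGF' : G =ᶠ[𝓝 x] F := by
    refine eventuallyEq_of_nhdsNE hG hFs.continuousAt ?_
    filter_upwards [hGF, hgood] with t ht hg
    rw [ht, pfEval, ← add_sum_erase _ _ (mem_range.2 (Nat.lt_succ_of_le hp)), hF, hH]
    simp only
    have hu : t - x = t + p + 1 := by rw [hx]; ring
    rw [hu, add_mul, sum_mul, mul_comm _ (∑ p' ∈ (range (n + 1)).erase p, _)]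
    congr 1
    refine sum_congr rfl fun o ho => ?_
    have ho' := mem_range.1 ho
    have hpow : (t + p + 1) ^ K = (t + p + 1) ^ (o + 1) * (t + p + 1) ^ (K - 1 - o) := by
      rw [← pow_add]; congr 1; omega
    have hu0 : (t + p + 1 : ℚ) ^ (o + 1) ≠ 0 := pow_ne_zero _ hg.1
    rw [hpow]
    calc c o p * ((t + ↑p + 1) ^ (o + 1))⁻¹ * ((t + ↑p + 1) ^ (o + 1) * (t + ↑p + 1) ^ (K - 1 - o))
        = c o p * (t + ↑p + 1) ^ (K - 1 - o) * (((t + ↑p + 1) ^ (o + 1))⁻¹ * (t + ↑p + 1) ^ (o + 1)) := by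
          ring
      _ = c o p * (t + ↑p + 1) ^ (K - 1 - o) := by rw [inv_mul_cancel₀ hu0, mul_one]
  -- compute the divided derivative of `F`
  rw [divDeriv_congr hGF', hF]
  have ha' : ContDiffAt ℚ a (fun t => (t - x) ^ K * H t) x :=
    ((contDiffAt_sub_pow _ _ _).mul hHs).of_le (mod_cast le_top)
  rw [divDeriv_fun_add ((ContDiffAt.sum fun o ho => hterm o ho).of_le (mod_cast le_top)) ha',
    divDeriv_sub_pow_mul (hHs.of_le (mod_cast le_top)) K, if_pos ha, add_zero,
    divDeriv_sum fun o ho => (hterm o ho).of_le (mod_cast le_top)]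
  simp_rw [divDeriv_const_mul, divDeriv_sub_pow]
  rw [sum_eq_single_of_mem (K - 1 - a) (mem_range.2 (by omega))]
  · rw [if_pos (by omega), mul_one]
  · intro o ho hoa
    rw [if_neg (by have := mem_range.1 ho; omega), mul_zero]

/-! ### The regularised product at the pole `-(p+1)` -/

/-- `G_p(t) = (2t+b₀+2) · C(t+b₃, b₃) · C(t+b₀+1, b₂) · ∏_{pairs} (L−1)!·(t+p+1)/(t+b_j+1)_{L}` (each reciprocal brick
regularised at `-(p+1)` by one factor `t+p+1`). -/
def Gfun (b : ℕ → ℤ) (p : ℕ) (t : ℚ) : ℚ :=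
  (2 * t + ((bn b 0 : ℚ) + 2)) * polyBrick 1 (bn b 3) t * polyBrick ((bn b 0 : ℤ) - bn b 2 + 2) (bn b 2) t
    * ∏ s ∈ range 6, recipBrickReg ((bn b (pfst s) : ℤ) + 1) (blockLen b s) ((p : ℤ) + 1) t

/-- **`D_{b₀}^j · (1/j!) G_p^{(j)}(−p−1) ∈ ℤ` for `j ≤ 5`** (Zudilin 2004, Lemmas 15–16, through the tree's
`polyBrick_isDInt`, `recipBrickReg_isDInt` and the product rule `IsDInt.mul/prod`). -/
theorem Gfun_isDInt {b : ℕ → ℤ} (hP : ∀ s, s < 6 → bn b (pfst s) + bn b (psnd s) ≤ bn b 0)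
    {p : ℕ} (hp : p ≤ bn b 0) :
    IsDInt (Nat.lcmUpto (bn b 0)) 5 (Gfun b p) (-(((p : ℤ) + 1 : ℤ) : ℚ)) := by
  have h3 : bn b 3 ≤ bn b 0 := by have := hP 5 (by norm_num); simp only [pfst, psnd] at this; omega
  have h2 : bn b 2 ≤ bn b 0 := by have := hP 2 (by norm_num); simp only [pfst, psnd] at this; omega
  -- the linear factor
  have hlin : IsDInt (Nat.lcmUpto (bn b 0)) 5 (fun t : ℚ => 2 * t + ((bn b 0 : ℚ) + 2)) (-(((p : ℤ) + 1 : ℤ) : ℚ)) :=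
    IsDInt.affine _ _ ⟨2 * (-((p : ℤ) + 1)) + (bn b 0 + 2), by push_cast; ring⟩
      ⟨(Nat.lcmUpto (bn b 0) : ℤ) * 2, by push_cast; ring⟩
  -- the two polynomial bricks
  have hf3 : IsDInt (Nat.lcmUpto (bn b 0)) 5 (polyBrick 1 (bn b 3)) (-(((p : ℤ) + 1 : ℤ) : ℚ)) :=
    (polyBrick_isDInt_neg 1 (bn b 3) ((p : ℤ) + 1) 5).of_dvd (lcmUpto_dvd_lcmUpto h3)
  have hs2 : IsDInt (Nat.lcmUpto (bn b 0)) 5 (polyBrick ((bn b 0 : ℤ) - bn b 2 + 2) (bn b 2))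
      (-(((p : ℤ) + 1 : ℤ) : ℚ)) :=
    (polyBrick_isDInt_neg _ (bn b 2) ((p : ℤ) + 1) 5).of_dvd (lcmUpto_dvd_lcmUpto h2)
  -- the six reciprocal bricks, blocks inside `[1, b₀+2)`
  have hrec : ∀ s ∈ range 6, IsDInt (Nat.lcmUpto (bn b 0)) 5
      (recipBrickReg ((bn b (pfst s) : ℤ) + 1) (blockLen b s) ((p : ℤ) + 1)) (-(((p : ℤ) + 1 : ℤ) : ℚ)) := by
    intro s hs
    have hs' := mem_range.1 hs
    have hle := hP s hs'
    have h := recipBrickReg_isDInt (a₀ := 1) (b₀ := (bn b 0 : ℤ) + 2) (a := (bn b (pfst s) : ℤ) + 1)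
      (m := blockLen b s) (k := (p : ℤ) + 1) (by unfold blockLen; omega) (by omega)
      (by unfold blockLen; omega) (by omega) (by omega) 5
    have e : ((bn b 0 : ℤ) + 2 - 1 - 1).toNat = bn b 0 := by omega
    rwa [e] at h
  unfold Gfun
  exact ((hlin.mul hf3).mul hs2).mul (IsDInt.prod (range 6) hrec)

/-- A reciprocal brick of the product is `(L−1)!/m_s`. -/
theorem recipBrick_eq_div (b : ℕ → ℤ) (s : ℕ) (t : ℚ) :
    recipBrick ((bn b (pfst s) : ℤ) + 1) (blockLen b s) t = (((blockLen b s - 1).factorial : ℕ) : ℚ) / mF b t s := by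
  rw [recipBrick, mF, poch, div_eq_mul_inv, ← prod_inv_distrib]
  congr 1
  refine prod_congr rfl fun l _ => ?_
  congr 1
  push_cast
  ring

/-- The polynomial bricks are `f₃/b₃!` and `s₂/b₂!`. -/
theorem polyBricks_eq (b : ℕ → ℤ) (t : ℚ) :
    polyBrick 1 (bn b 3) t = fF b t 3 / ((bn b 3).factorial : ℚ)
    ∧ polyBrick ((bn b 0 : ℤ) - bn b 2 + 2) (bn b 2) t = sF b t 2 / ((bn b 2).factorial : ℚ) := by
  refine ⟨?_, ?_⟩
  · rw [polyBrick, fF, poch]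
    congr 1
  · rw [polyBrick, sF, poch]
    congr 1
    all_goals (refine prod_congr rfl fun l _ => ?_; push_cast; try ring)

/-- **The sharp normaliser** `N♯(b) = N(b)/(b₂! b₃!)` — Brown–Zudilin's factor in (35). -/
def sharpNormaliser (b : ℕ → ℤ) : ℚ :=
  (normaliser b : ℚ) / (((bn b 2).factorial : ℚ) * ((bn b 3).factorial : ℚ))

/-- **`G_p = (t+p+1)⁶ · N♯(b) · R_b` away from the poles**, through any partial-fraction data `c` of `R_b`:
`Gfun b p t = pfEval n 6 (N♯·c) t · (t+p+1)⁶`. -/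
theorem Gfun_eq {b : ℕ → ℤ} (hb : InBox b) (hP : ∀ s, s < 6 → bn b (pfst s) + bn b (psnd s) ≤ bn b 0)
    {c : ℕ → ℕ → ℚ} (hc : IsPFData b c) (p : ℕ) (t : ℚ) (htp : t + p + 1 ≠ 0)
    (ht : ∀ q, q ≤ bn b 0 → t + q + 1 ≠ 0) :
    Gfun b p t = pfEval (bn b 0) 6 (fun o q => sharpNormaliser b * c o q) t * (t + p + 1) ^ 6 := by
  have hmain := normaliser_mul_eq hb hP t ht
  have hct : pfEval (bn b 0) 6 c t
      = ((numPoly b).comp (X + C 1)).eval t / poch (t + 1) (bn b 0 + 1) ^ 6 := hc t ht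
  rw [pfEval_const_mul, hct, sharpNormaliser, Gfun]
  -- expand the six regularised bricks
  have hreg : ∀ s ∈ range 6, recipBrickReg ((bn b (pfst s) : ℤ) + 1) (blockLen b s) ((p : ℤ) + 1) t
      = (((blockLen b s - 1).factorial : ℕ) : ℚ) / mF b t s * (t + p + 1) := by
    intro s _
    rw [recipBrickReg_eq _ _ _ (by push_cast; intro h0; exact htp (by linarith)), recipBrick_eq_div]
    push_cast
    ring
  rw [prod_congr rfl hreg, prod_mul_distrib, prod_const, card_range, (polyBricks_eq b t).1,
    (polyBricks_eq b t).2]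
  -- bricks as brickEvals and the product identity
  have hbr : ∏ s ∈ range 6, (((blockLen b s - 1).factorial : ℕ) : ℚ) / mF b t s
      = ∏ s ∈ range 6, brickEval (bn b 0) (brickA b s) t :=
    prod_congr rfl fun s hs => (brick_eq hP t ht s (mem_range.1 hs)).symm
  rw [hbr]
  have hlin := linProd_linFactors b t
  rw [ell] at hlin
  have h2 : ((bn b 2).factorial : ℚ) ≠ 0 := by positivity
  have h3 : ((bn b 3).factorial : ℚ) ≠ 0 := by positivity
  -- `hmain : N * (numPoly../poch^6) = (ℓ f₃ s₂) * ∏ brick`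
  rw [hlin] at hmain
  linear_combination
    (-((t + ↑p + 1) ^ 6 / (((bn b 2).factorial : ℚ) * ((bn b 3).factorial : ℚ)))) * hmain

/-- **`d^{5−o} · N♯(b) · c_{o,p} ∈ ℤ`** for THE data of `R_b` (`o < 6`, `p ≤ b₀`, `d = lcm(1..b₀)`): Brown–Zudilin's
normalisation (35), proved up to one factor `d` on the `ζ(5)`-coefficient. -/
theorem exists_int_data_sharp {b : ℕ → ℤ} (hb : InBox b)
    (hP : ∀ s, s < 6 → bn b (pfst s) + bn b (psnd s) ≤ bn b 0)
    (hsum : ∑ j ∈ range 7, b (j + 1) ≤ 3 * b 0 + 1) :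
    ∃ c : ℕ → ℕ → ℚ, IsPFData b c ∧
      ∀ o p, o < 6 → p ≤ bn b 0 →
        ∃ z : ℤ, ((Nat.lcmUpto (bn b 0) : ℕ) : ℚ) ^ (5 - o) * (sharpNormaliser b * c o p) = z := by
  obtain ⟨c, hc⟩ := exists_isPFData b hb hsum
  refine ⟨c, hc, fun o p ho hp => ?_⟩
  have hG := Gfun_isDInt hP hp
  have hx : (-(((p : ℤ) + 1 : ℤ) : ℚ)) = -(p : ℚ) - 1 := by push_cast; ring
  rw [hx] at hG
  -- the bridge
  have hcoef := divDeriv_eq_coeff (bn b 0) 6 (fun o q => sharpNormaliser b * c o q) (Gfun b p) hp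
    hG.contDiffAt.continuousAt ?_ (a := 5 - o) (by omega)
  · obtain ⟨z, hz⟩ := hG.isInt (5 - o) (by omega)
    refine ⟨z, ?_⟩
    rw [← hz, hcoef, show 6 - 1 - (5 - o) = o by omega]
  · -- `Gfun = pfEval · (t+p+1)^6` on a punctured neighbourhood
    have h := eventually_ne_poles (1 : ℤ) (bn b 0 + 1) ((p : ℤ) + 1)
    rw [show (-(((p : ℤ) + 1 : ℤ) : ℚ)) = -(p : ℚ) - 1 by push_cast; ring] at h
    filter_upwards [h] with t ht
    have htp : t + p + 1 ≠ 0 := by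
      have := ht.1; push_cast at this; intro h0; exact this (by linarith)
    have htq : ∀ q, q ≤ bn b 0 → t + q + 1 ≠ 0 := by
      intro q hq h0
      have := ht.2 q (mem_range.2 (by omega)); push_cast at this; exact this (by linarith)
    exact Gfun_eq hb hP hc p t htp htq

/-- **`d · N♯(b) · U(b) ∈ ℤ`** — the `ζ(5)`-coefficient with Brown–Zudilin's normaliser (35) and one `d = lcm(1..b₀)`. -/
theorem coeffU_den_sharp {b : ℕ → ℤ} (hb : InBox b)
    (hP : ∀ s, s < 6 → bn b (pfst s) + bn b (psnd s) ≤ bn b 0)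
    (hsum : ∑ j ∈ range 7, b (j + 1) ≤ 3 * b 0 + 1) :
    ∃ z : ℤ, ((Nat.lcmUpto (bn b 0) : ℕ) : ℚ) * sharpNormaliser b * coeffU b = z := by
  obtain ⟨c, hc, hint⟩ := exists_int_data_sharp hb hP hsum
  have hterm : ∀ p ∈ range (bn b 0 + 1), ∃ z : ℤ,
      ((Nat.lcmUpto (bn b 0) : ℕ) : ℚ) * sharpNormaliser b * c 4 p = z := by
    intro p hp
    obtain ⟨z, hz⟩ := hint 4 p (by norm_num) (Nat.lt_succ_iff.1 (mem_range.1 hp))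
    refine ⟨z, ?_⟩
    rw [← hz, show (5 : ℕ) - 4 = 1 by rfl, pow_one]
    ring
  choose z hz using hterm
  refine ⟨∑ p ∈ (range (bn b 0 + 1)).attach, z p.1 p.2, ?_⟩
  rw [coeffU_eq hc, show (b 0).toNat = bn b 0 by rfl, mul_sum, ← sum_attach]
  push_cast
  exact sum_congr rfl fun p _ => hz p.1 p.2

/-- **`d³ · N♯(b) · W(b) ∈ ℤ`** — the `ζ(3)`-coefficient with Brown–Zudilin's normaliser (35). -/
theorem coeffW_den_sharp {b : ℕ → ℤ} (hb : InBox b)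
    (hP : ∀ s, s < 6 → bn b (pfst s) + bn b (psnd s) ≤ bn b 0)
    (hsum : ∑ j ∈ range 7, b (j + 1) ≤ 3 * b 0 + 1) :
    ∃ z : ℤ, ((Nat.lcmUpto (bn b 0) : ℕ) : ℚ) ^ 3 * sharpNormaliser b * coeffW b = z := by
  obtain ⟨c, hc, hint⟩ := exists_int_data_sharp hb hP hsum
  have hterm : ∀ p ∈ range (bn b 0 + 1), ∃ z : ℤ,
      ((Nat.lcmUpto (bn b 0) : ℕ) : ℚ) ^ 3 * sharpNormaliser b * c 2 p = z := by
    intro p hp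
    obtain ⟨z, hz⟩ := hint 2 p (by norm_num) (Nat.lt_succ_iff.1 (mem_range.1 hp))
    refine ⟨z, ?_⟩
    rw [← hz, show (5 : ℕ) - 2 = 3 by rfl]
    ring
  choose z hz using hterm
  refine ⟨∑ p ∈ (range (bn b 0 + 1)).attach, z p.1 p.2, ?_⟩
  rw [coeffW_eq hc, show (b 0).toNat = bn b 0 by rfl, mul_sum, ← sum_attach]
  push_cast
  exact sum_congr rfl fun p _ => hz p.1 p.2

end DualSeriesDenominators

end Summit.KontsevichZagierPeriods.Zeta5Search
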